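import Mathlib
import Literature.RepresentationTheory.FiniteGroups.CharacterDegrees
import Literature.RepresentationTheory.FiniteGroups.IrreducibleCharacters
import Literature.RepresentationTheory.FiniteGroups.InducedClassFunction
import Literature.RepresentationTheory.FiniteGroups.BrauerInduction
import Literature.RepresentationTheory.FiniteGroups.BrauerTheorem
import Literature.RepresentationTheory.FiniteGroups.MonomialRepresentation
import Literature.RepresentationTheory.FiniteGroups.GLBlockParabolic
import Summits.MatrixMultiplication.MatrixMultiplication.Theorems.LieRankDesigns.Negative.Basics
import Summits.MatrixMultiplication.MatrixMultiplication.Theorems.LevelGradedCohnUmansLieRankDesignsStubLevelOfFixedVector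
import Summits.MatrixMultiplication.MatrixMultiplication.Theorems.SubgroupIdentityDesigns.Negative.BorelLevelOne
import Summits.MatrixMultiplication.MatrixMultiplication.Theorems.SubgroupIdentityDesigns.Negative.BlockSliceTypes
import Summits.MatrixMultiplication.MatrixMultiplication.Theorems.SubgroupIdentityDesigns.Negative.BlockSliceNoGo
import Summits.MatrixMultiplication.MatrixMultiplication.Theorems.SubgroupIdentityDesigns.Negative.BlockSliceTranslate

/-!
# The permutation character of `GL_{k+l}(F)` on `k`-subspaces: level `≤ k`, degree `≥ |F|^{kl}`

Supports stmt-MatrixMultiplication-14079 (route `LevelGradedCohnUmans`).  VALUE = theorem, NOT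
    summit
progress.  Towards BLOCK-SLICES Lemma 2.1 for GENERAL `k` without unipotent character theory: with
`P = subspaceStab` the stabiliser of the standard `k`-subspace `W₀ = ⟨e_1, …, e_k⟩ ≤ F^{k+l}` (the
maximal parabolic `(A B; 0 D)`, transported from `GLBlock.parabolic` along `BlockSliceNoGo.toSum`)
and `Φ = Ind_P^G 1 = grassChar` the permutation character of `G = GL_{k+l}(F)` on `k`-subspaces:

* `mem_subspaceStab_iff_frame` — `h ∈ P ↔ ∃ A, h E = E A` (`E = (1; 0)` the standard `n × k`
  frame), and `smul_eq_iff_frame` — `y` fixes the coset `xP` iff `y (xE) = (xE) A` for a (unique,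
  `frame_coeff_unique`) `k × k` matrix `A`;
* `grassChar_apply_eq_sum` — hence `Φ(y) = ∑_{q ∈ G/P} ∑_{A} [y X_q = X_q A]` is a sum of rank-`k`
  FRAME INDICATORS, so over `𝔽_p` **`Φ ∈ F_k`** (`grassChar_mem_levelSet`,
  via `BorelLevelOne.frameIndicator_mem_levelSet`);
* `isCharacter_grassChar`, `grassChar_one` — `Φ` is a character of degree `[G : P]`, and
  `card_quotient_ge` — **`[G : P] ≥ |F|^{kl}`** (the lower shears `(1 0; C 1)`, `C ∈ F^{l×k}`, lie
      in
  distinct cosets); over `𝔽_p`: `grassChar_one_ge` — `(Φ 1).re ≥ p^{kl}`.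

With `ConstituentLevel.exists_irrChar_levelSet_degree_ge` this gives an irreducible `ψ ∈ Irr ∩ F_k`
with `ψ(1) ≥ p^{kl} / ⟨Φ, Φ⟩`; the remaining input for the general-`k` no-go is the orbit count
`⟨Φ, Φ⟩ = |P\G/P| = k + 1` (`l ≥ k`; pairs of `k`-subspaces are classified by `dim (W ∩ W')`).
-/

set_option linter.dupNamespace false

noncomputable section

open scoped BigOperators Matrix Classical
open Literature.RepresentationTheory.FiniteGroups
open Summit.MatrixMultiplication.MatrixMultiplication.Theorems.LieRankDesigns.Negative
  (GLm Mat levelSet character_trivial_apply)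
open Summit.MatrixMultiplication.MatrixMultiplication.Theorems.LieRankDesigns.LevelOfFixedVector
  (sum_mem_levelSet)

namespace Summit.MatrixMultiplication.MatrixMultiplication.Theorems.SubgroupIdentityDesigns.Negative
namespace GrassmannCharacter

open BlockSliceTypes (Ablk Bblk Cblk Dblk Ablk_mul Cblk_mul)
open BlockSliceNoGo (toSum toSumHom)
open BlockSliceTranslate (shear Ablk_shear Bblk_shear Cblk_shear Dblk_shear)

section General

variable {F : Type} [Field F] [Fintype F] [DecidableEq F] {k l : ℕ}


/-! ## The stabiliser of the standard `k`-subspace -/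

/-- `P`: the stabiliser of `W₀ = ⟨e_1, …, e_k⟩`, i.e. the block upper triangular matrices
`(A B; 0 D)` (`GLBlock.parabolic` pulled back along the reindexing `toSum`). -/
def subspaceStab (F : Type) [Field F] (k l : ℕ) : Subgroup (GL (Fin (k + l)) F) :=
  (GLBlock.parabolic F (Fin k) (Fin l)).comap (toSumHom (F := F) (k := k) (l := l))


omit [Fintype F] [DecidableEq F] in
/-- Entries of the lower-left block after reindexing: `C(toSum g)ᵢⱼ = g_{k+i, j}`. -/
theorem Cblk_toSum (g : (GL (Fin (k + l)) F)) (i : Fin l) (j : Fin k) :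
    Cblk (toSumHom g) i j = (g : (Matrix (Fin (k + l)) (Fin (k + l)) F)) (Fin.natAdd k i)
        (Fin.castAdd l j) := by
  simp [Cblk, toSumHom, toSum, Matrix.toBlocks₂₁, Units.coe_mapEquiv, Matrix.reindex_apply,
    Matrix.submatrix_apply]

omit [Fintype F] [DecidableEq F] in
/-- Membership in `P`: the lower-left `l × k` block vanishes. -/
theorem mem_subspaceStab_iff (g : (GL (Fin (k + l)) F)) :
    g ∈ (subspaceStab F k l) ↔ ∀ (i : Fin l) (j : Fin k), (g : (Matrix (Fin (k + l)) (Fin (k + l))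
        F)) (Fin.natAdd k i) (Fin.castAdd l j) = 0 := by
  show Cblk (toSumHom g) = 0 ↔ _
  simp only [← Matrix.ext_iff, Cblk_toSum, Matrix.zero_apply]

/-! ## Frames -/

/-- The standard `n × k` frame `E = (1; 0)` (the first `k` columns of the identity). -/
def stdFrame (F : Type) [Field F] (k l : ℕ) : Matrix (Fin (k + l)) (Fin k) F :=
  fun i j => (1 : Matrix (Fin (k + l)) (Fin (k + l)) F) i (Fin.castAdd l j)


omit [Fintype F] [DecidableEq F] in
/-- `(h E)_{i j} = h_{i, j}` (the first `k` columns of `h`). -/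
theorem mul_stdFrame_apply (h : (Matrix (Fin (k + l)) (Fin (k + l)) F)) (i : Fin (k + l)) (j : Fin
    k) :
    (h * (stdFrame F k l)) i j = h i (Fin.castAdd l j) := by
  simp [stdFrame, Matrix.mul_apply, Matrix.one_apply]

omit [Fintype F] [DecidableEq F] in
/-- `castAdd j ≠ natAdd i`. -/
theorem castAdd_ne_natAdd (j : Fin k) (i : Fin l) : (Fin.castAdd l j : Fin (k + l)) ≠ Fin.natAdd k
    i := by
  intro h
  have := congrArg Fin.val h
  simp at this
  omega

omit [Fintype F] [DecidableEq F] in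
/-- `(E A)_{castAdd i, j} = A_{i j}`. -/
theorem stdFrame_mul_castAdd (A : Matrix (Fin k) (Fin k) F) (i j : Fin k) :
    ((stdFrame F k l) * A) (Fin.castAdd l i) j = A i j := by
  simp only [stdFrame, Matrix.mul_apply, Matrix.one_apply, Fin.castAdd_inj, ite_mul, one_mul,
    zero_mul, Finset.sum_ite_eq, Finset.mem_univ, if_true]

omit [Fintype F] [DecidableEq F] in
/-- `(E A)_{natAdd i, j} = 0`. -/
theorem stdFrame_mul_natAdd (A : Matrix (Fin k) (Fin k) F) (i : Fin l) (j : Fin k) :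
    ((stdFrame F k l) * A) (Fin.natAdd k i) j = 0 := by
  simp only [stdFrame, Matrix.mul_apply, Matrix.one_apply]
  refine Finset.sum_eq_zero fun x _ => ?_
  rw [if_neg (castAdd_ne_natAdd x i).symm, zero_mul]

omit [Fintype F] [DecidableEq F] in
/-- **`h ∈ P ↔ h E = E A` for some `k × k` matrix `A`** (namely the upper-left block of `h`). -/
theorem mem_subspaceStab_iff_frame (h : (GL (Fin (k + l)) F)) :
    h ∈ (subspaceStab F k l) ↔ ∃ A : Matrix (Fin k) (Fin k) F, (h : (Matrix (Fin (k + l)) (Fin (k +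
        l)) F)) * (stdFrame F k l) = (stdFrame F k l) * A := by
  rw [mem_subspaceStab_iff]
  constructor
  · intro hP
    refine ⟨fun i j => (h : (Matrix (Fin (k + l)) (Fin (k + l)) F)) (Fin.castAdd l i) (Fin.castAdd
        l j), Matrix.ext fun i j => ?_⟩
    induction i using Fin.addCases with
    | left i => rw [mul_stdFrame_apply, stdFrame_mul_castAdd]
    | right i => rw [mul_stdFrame_apply, stdFrame_mul_natAdd, hP]
  · rintro ⟨A, hA⟩ i j
    have h' := congrFun (congrFun hA (Fin.natAdd k i)) j
    rwa [mul_stdFrame_apply, stdFrame_mul_natAdd] at h'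

omit [Fintype F] [DecidableEq F] in
/-- Conjugation moves the frame: `(x⁻¹ y x) E = E A ↔ y (x E) = (x E) A`. -/
theorem conj_frame_iff (x y : (GL (Fin (k + l)) F)) (A : Matrix (Fin k) (Fin k) F) :
    ((x⁻¹ * y * x : (GL (Fin (k + l)) F)) : (Matrix (Fin (k + l)) (Fin (k + l)) F)) * (stdFrame F k
        l) = (stdFrame F k l) * A ↔ (y : (Matrix (Fin (k + l)) (Fin (k + l)) F)) * ((x : (Matrix
        (Fin (k + l)) (Fin (k + l)) F)) * (stdFrame F k l)) = (x : (Matrix (Fin (k + l)) (Fin (k +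
        l)) F)) * (stdFrame F k l) * A := by
  simp only [Units.val_mul]
  constructor
  · intro h
    calc (y : (Matrix (Fin (k + l)) (Fin (k + l)) F)) * ((x : (Matrix (Fin (k + l)) (Fin (k + l))
        F)) * (stdFrame F k l))
        = (x : (Matrix (Fin (k + l)) (Fin (k + l)) F)) * (((x⁻¹ : (GL (Fin (k + l)) F)) : (Matrix
            (Fin (k + l)) (Fin (k + l)) F)) * (y : (Matrix (Fin (k + l)) (Fin (k + l)) F)) * (x :
            (Matrix (Fin (k + l)) (Fin (k + l)) F)) * (stdFrame F k l)) := by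
          simp only [← Matrix.mul_assoc, Units.mul_inv, Matrix.one_mul]
      _ = (x : (Matrix (Fin (k + l)) (Fin (k + l)) F)) * (stdFrame F k l) * A := by rw [h,
          Matrix.mul_assoc]
  · intro h
    calc ((x⁻¹ : (GL (Fin (k + l)) F)) : (Matrix (Fin (k + l)) (Fin (k + l)) F)) * (y : (Matrix
        (Fin (k + l)) (Fin (k + l)) F)) * (x : (Matrix (Fin (k + l)) (Fin (k + l)) F)) * (stdFrame
        F k l)
        = ((x⁻¹ : (GL (Fin (k + l)) F)) : (Matrix (Fin (k + l)) (Fin (k + l)) F)) * ((y : (Matrix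
            (Fin (k + l)) (Fin (k + l)) F)) * ((x : (Matrix (Fin (k + l)) (Fin (k + l)) F)) *
            (stdFrame F k l))) := by simp only [Matrix.mul_assoc]
      _ = (stdFrame F k l) * A := by rw [h]; simp only [← Matrix.mul_assoc, Units.inv_mul,
          Matrix.one_mul]

omit [Fintype F] [DecidableEq F] in
/-- The coefficient matrix of a fixed frame is unique: `x E A = x E A' → A = A'`. -/
theorem frame_coeff_unique (x : (GL (Fin (k + l)) F)) {A A' : Matrix (Fin k) (Fin k) F}
    (h : (x : (Matrix (Fin (k + l)) (Fin (k + l)) F)) * (stdFrame F k l) * A = (x : (Matrix (Fin (k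
        + l)) (Fin (k + l)) F)) * (stdFrame F k l) * A') : A = A' := by
  have h' : (stdFrame F k l) * A = (stdFrame F k l) * A' := by
    have := congrArg (fun N => ((x⁻¹ : (GL (Fin (k + l)) F)) : (Matrix (Fin (k + l)) (Fin (k + l))
        F)) * N) h
    simpa only [← Matrix.mul_assoc, Units.inv_mul, Matrix.one_mul] using this
  ext i j
  rw [← stdFrame_mul_castAdd (l := l) A i j, h', stdFrame_mul_castAdd]

omit [Fintype F] [DecidableEq F] in
/-- **`y` fixes the coset `q = xP` iff `y (x E) = (x E) A` for some `A`.** -/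
theorem smul_eq_iff_frame (y : (GL (Fin (k + l)) F)) (q : (GL (Fin (k + l)) F ⧸ subspaceStab F k
    l)) :
    y • q = q ↔ ∃ A : Matrix (Fin k) (Fin k) F,
      (y : (Matrix (Fin (k + l)) (Fin (k + l)) F)) * (((q.out : (GL (Fin (k + l)) F)) : (Matrix
          (Fin (k + l)) (Fin (k + l)) F)) * (stdFrame F k l)) = ((q.out : (GL (Fin (k + l)) F)) :
          (Matrix (Fin (k + l)) (Fin (k + l)) F)) * (stdFrame F k l) * A := by
  rw [smul_eq_self_iff_mem _ y q, mem_subspaceStab_iff_frame]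
  exact exists_congr fun A => conj_frame_iff _ _ A

/-- The fixed-coset indicator is a sum of frame indicators:
`[y • q = q] = ∑_A [y X_q = X_q A]`, `X_q = q.out E`. -/
theorem ite_smul_eq_sum (y : (GL (Fin (k + l)) F)) (q : (GL (Fin (k + l)) F ⧸ subspaceStab F k l)) :
    (if y • q = q then (1 : ℂ) else 0) = ∑ A : Matrix (Fin k) (Fin k) F,
      (if (y : (Matrix (Fin (k + l)) (Fin (k + l)) F)) * (((q.out : (GL (Fin (k + l)) F)) : (Matrix
          (Fin (k + l)) (Fin (k + l)) F)) * (stdFrame F k l)) = ((q.out : (GL (Fin (k + l)) F)) :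
          (Matrix (Fin (k + l)) (Fin (k + l)) F)) * (stdFrame F k l) * A then (1 : ℂ) else 0) := by
  by_cases h : y • q = q
  · obtain ⟨A, hA⟩ := (smul_eq_iff_frame y q).mp h
    rw [if_pos h, Finset.sum_eq_single A]
    · rw [if_pos hA]
    · intro A' _ hA'
      rw [if_neg]
      intro h'
      exact hA' (frame_coeff_unique _ (hA.symm.trans h')).symm
    · intro hA'
      exact absurd (Finset.mem_univ A) hA'
  · rw [if_neg h]
    refine (Finset.sum_eq_zero fun A _ => ?_).symm
    rw [if_neg]
    exact fun hA => h ((smul_eq_iff_frame y q).mpr ⟨A, hA⟩)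

/-! ## The permutation character `Φ = Ind_P^G 1` -/

/-- `Φ = Ind_P^G 1`, the permutation character of `GL_{k+l}(F)` on `k`-subspaces. -/
def grassChar (F : Type) [Field F] [Fintype F] [DecidableEq F] (k l : ℕ) : GL (Fin (k + l)) F → ℂ :=
  indClassFun (subspaceStab F k l) (fun _ => (1 : ℂ))

/-- `Φ` is a character (of the monomial representation `Ind_P^G 1`). -/
theorem isCharacter_grassChar : IsCharacter (GL (Fin (k + l)) F) (grassChar F k l) := by
  have h : (fun h : (subspaceStab F k l) => (((1 : (subspaceStab F k l) →* ℂˣ) h : ℂˣ) : ℂ)) = fun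
      _ => 1 := funext fun h => by simp
  have := isCharacter_indClassFun_monoidHom (subspaceStab F k l) 1
  rw [h] at this
  exact this

/-- `Φ(y)` counts the fixed cosets (`k`-subspaces): `Φ(y) = ∑_q [y • q = q]`. -/
theorem grassChar_apply (y : (GL (Fin (k + l)) F)) :
    grassChar F k l y = ∑ q : (GL (Fin (k + l)) F ⧸ subspaceStab F k l), (if y • q = q then (1 : ℂ)
        else 0) := by
  unfold grassChar
  rw [indClassFun_eq_sum_quotient _ (fun _ _ => rfl)]
  refine Finset.sum_congr rfl fun q _ => ?_
  by_cases hq : y • q = q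
  · rw [if_pos hq]
    exact extend_subtypeVal_apply _ _ ⟨_, (smul_eq_self_iff_mem _ y q).mp hq⟩
  · rw [if_neg hq]
    exact extend_subtypeVal_of_not_mem _ _ fun hm => hq ((smul_eq_self_iff_mem _ y q).mpr hm)

/-- **Frame expansion**: `Φ(y) = ∑_{q ∈ G/P} ∑_A [y X_q = X_q A]`. -/
theorem grassChar_apply_eq_sum (y : (GL (Fin (k + l)) F)) :
    grassChar F k l y = ∑ q : (GL (Fin (k + l)) F ⧸ subspaceStab F k l), ∑ A : Matrix (Fin k) (Fin
        k) F,
      (if (y : (Matrix (Fin (k + l)) (Fin (k + l)) F)) * (((q.out : (GL (Fin (k + l)) F)) : (Matrix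
          (Fin (k + l)) (Fin (k + l)) F)) * (stdFrame F k l)) = ((q.out : (GL (Fin (k + l)) F)) :
          (Matrix (Fin (k + l)) (Fin (k + l)) F)) * (stdFrame F k l) * A then (1 : ℂ) else 0) := by
  rw [grassChar_apply]
  exact Finset.sum_congr rfl fun q _ => ite_smul_eq_sum y q

/-- `Φ(1) = [G : P]`. -/
theorem grassChar_one : grassChar F k l 1 = (Fintype.card (GL (Fin (k + l)) F ⧸ subspaceStab F k l)
    : ℂ) := by
  rw [grassChar_apply]
  simp only [one_smul, if_true, Finset.sum_const, Finset.card_univ, nsmul_eq_mul, mul_one]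

/-! ## `[G : P] ≥ |F|^{kl}` -/

omit [Fintype F] [DecidableEq F] in
/-- The inverse of a lower shear. -/
theorem shear_inv (C : Matrix (Fin l) (Fin k) F) : (shear C)⁻¹ = shear (-C) :=
  Units.ext rfl

omit [Fintype F] [DecidableEq F] in
/-- `(shear C)⁻¹ shear C' ∈ (A B; 0 D)` only if `C = C'`. -/
theorem shear_coset_injective {C C' : Matrix (Fin l) (Fin k) F}
    (h : Cblk ((shear C)⁻¹ * shear C') = 0) : C = C' := by
  rw [shear_inv, Cblk_mul, Cblk_shear, Ablk_shear, Dblk_shear, Cblk_shear, Matrix.mul_one,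
    Matrix.one_mul, neg_add_eq_sub, sub_eq_zero] at h
  exact h.symm

/-- **`[G : P] ≥ |F|^{kl}`**: the lower shears `(1 0; C 1)` lie in pairwise distinct cosets of `P`.
    -/
theorem card_quotient_ge : Fintype.card F ^ (k * l) ≤ Fintype.card (GL (Fin (k + l)) F ⧸
    subspaceStab F k l) := by
  let emb : (Fin l → Fin k → F) → (GL (Fin (k + l)) F ⧸ subspaceStab F k l) := fun C =>
    (((toSum (F := F) (k := k) (l := l)).symm (shear (Matrix.of C)) : (GL (Fin (k + l)) F)) : (GL
        (Fin (k + l)) F ⧸ subspaceStab F k l))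
  have hinj : Function.Injective emb := by
    intro C C' h
    have hmem : ((toSum (F := F) (k := k) (l := l)).symm (shear (Matrix.of C)))⁻¹ *
        (toSum (F := F) (k := k) (l := l)).symm (shear (Matrix.of C')) ∈ subspaceStab F k l :=
      QuotientGroup.eq.mp h
    have hmem' : (shear (Matrix.of C))⁻¹ * shear (Matrix.of C') ∈
        GLBlock.parabolic F (Fin k) (Fin l) := by
      have h' := Subgroup.mem_comap.mp hmem
      rw [map_mul, map_inv] at h'
      simpa only [toSumHom, MulEquiv.coe_toMonoidHom, MulEquiv.apply_symm_apply] using h'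
    exact Matrix.of.injective (shear_coset_injective ((GLBlock.mem_parabolic_iff _).mp hmem'))
  have hcard := Fintype.card_le_of_injective emb hinj
  rwa [Fintype.card_fun, Fintype.card_fun, Fintype.card_fin, Fintype.card_fin, ← pow_mul] at hcard

end General

/-! ## Over `𝔽_p`: level and degree -/

variable {p : ℕ} [hp : Fact p.Prime] {k l : ℕ}

/-- **`Φ ∈ F_k`**: the permutation character on `k`-subspaces has Fourier level `≤ k`. -/
theorem grassChar_mem_levelSet : grassChar (ZMod p) k l ∈ levelSet p (k + l) k := by
  have h : grassChar (ZMod p) k l = fun y => ∑ q : GLm p (k + l) ⧸ subspaceStab (ZMod p) k l,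
      ∑ A : Matrix (Fin k) (Fin k) (ZMod p),
        (fun g : GLm p (k + l) => if (g : Mat p (k + l)) *
            (((q.out : GLm p (k + l)) : Mat p (k + l)) * stdFrame (ZMod p) k l) =
            ((q.out : GLm p (k + l)) : Mat p (k + l)) * stdFrame (ZMod p) k l * A
          then (1 : ℂ) else 0) y := funext fun y => grassChar_apply_eq_sum y
  rw [h]
  exact sum_mem_levelSet _ _ fun q _ => sum_mem_levelSet _ _ fun A _ =>
    frameIndicator_mem_levelSet _ _

/-- **`(Φ 1).re ≥ p^{kl}`.** -/
theorem grassChar_one_ge : ((p ^ (k * l) : ℕ) : ℝ) ≤ (grassChar (ZMod p) k l 1).re := by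
  rw [grassChar_one]
  simp only [Complex.natCast_re, Nat.cast_le]
  have h := card_quotient_ge (F := ZMod p) (k := k) (l := l)
  rwa [ZMod.card] at h

/-- `Φ 1 ≠ 0`. -/
theorem grassChar_one_ne_zero : grassChar (ZMod p) k l 1 ≠ 0 := by
  rw [grassChar_one, Nat.cast_ne_zero]
  exact Fintype.card_ne_zero

end GrassmannCharacter
end Summit.MatrixMultiplication.MatrixMultiplication.Theorems.SubgroupIdentityDesigns.Negative
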